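import Summits.ValiantsHypothesis.ValiantsHypothesis.Theorems.LacunarySymmetroidMatrixDescartesDoorA26WallBubblingNoBalanceKit

/-!
# `DoorA26` / line `wall_bubbling` — SIGN CUTS: the sign word of a function along a finite set of abscissae is cut out by the
midpoints of its flip gaps; flips give ordered zeros; the alternating virtual signs flip at most `20 − 2|J|` times along an honestly
encoded touch set

HONEST FRAMING.  Object-search cell `pub-symmetroid`, crux `Theses.LacunarySymmetroid.DoorA26` (stmt-ValiantsHypothesis-19979; OPEN, typed,
never asserted).  W2 seat val-sym-door-p1 g19, file #54; def-free helper for obligation (R) of `Cruxes/DoorA26/Lines/wall_bubbling.lean`, the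
combinatorial half of the no-balance proof (#53 `…NoBalanceKit` ← this file ← #55 `…NoBalance`).  It feeds #48's DISCRETE CHEBYSHEV ALTERNATION
`eq_zero_of_expEval_combination_signWord` (a kernel vector of the exponential point evaluations whose sign word is cut out by `≤ 5` change points
vanishes), whose currency is a strictly increasing family of change points `u` with `0 ≤ a_j ∏_i (u_i − τ_j)`.

WHAT IS HERE.  §1 `prod_orderEmbOfFin` (a product over a finset, enumerated increasingly), `sign_run` (the running sign of a nowhere-zero sequence
`a : Fin (k+1) → ℝ` relative to `a 0` is `(−1)^{#flip positions below}`), `midpoint_side`, `midpoint_strictMono`, and ★ `signCut`: for increasing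
abscissae `τ`, a set `A` of `k + 1` indices enumerated by `A.orderEmbOfFin`, and `f` nowhere zero on `A`, the set `W` of MIDPOINTS OF THE FLIP GAPS
(consecutive elements of `A` with `f·f < 0`) has `|W| = #flips`, avoids the abscissae of `A`, and CUTS OUT the sign word: `0 < f(e 0)·f_j·∏_{x ∈ W}(x − τ_j)`
on `A`.  §2 `exists_zeros_of_flips` (a continuous `g` flipping across `c` consecutive gaps of `A` has `c` strictly increasing zeros below `max A` —
intermediate value theorem, `Census.RealExp.exists_zero_of_mul_neg`), `card_filter_lt_succ`, `kappa_sign` (`0 < κ₀ κ_j (−1)^j` for the alternating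
virtual signs of the line's 21-abscissa currency), `odd_sub_of_kappa_flip`, and ★ `card_kappaFlips_le`: for a touch set `J ⊆ Fin 21` avoiding the
first and last abscissa and with no two adjacent indices (the HONEST ENCODING of a limit profile: one abscissa per constant-sign interval, one per
double zero), `#(flips of κ along J) + 2|J| ≤ 20` — consecutive gaps of `J` have index length `≥ 2`, flip gaps are odd hence `≥ 3`, all inside `{1,…,19}`.
READING for (R): in #55 the sign word of the short kernel vector `μ_jκ_j polar(X,P(τ_j))` is cut by (flip midpoints of `κ` along `J`, `≤ 2` of them
once `|J| ≥ 9`) Δ (flip midpoints of `polar(X,P(·))` along the support, `≤ 3` of them) — `≤ 5` change points, so #48 kills it.  Nothing here bears on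
`DoorA26`, `DoorA34`, (W)/(M)/(R) as typed, `MatrixDescartes` (18050) or `VP ≠ VNP`; registers unchanged.

[folklore] sign bookkeeping along a finite sequence; intermediate value theorem; parity of alternating signs.  [this work] the packaging and the
`20 − 2|J|` count.
-/

set_option linter.dupNamespace false

namespace Summit.ValiantsHypothesis.ValiantsHypothesis.Theorems.LacunarySymmetroidMatrixDescartes.WallBubbling

open Finset

/-! ## §1 Sign cuts by flip midpoints -/

/-- Products over a finset enumerated increasingly: `∏_{x ∈ W} g x = ∏_i g (W.orderEmbOfFin h i)`. [folklore] -/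
theorem prod_orderEmbOfFin {α : Type*} [LinearOrder α] (W : Finset α) {q : ℕ} (h : W.card = q) (g : α → ℝ) :
    ∏ i : Fin q, g (W.orderEmbOfFin h i) = ∏ x ∈ W, g x := by
  classical
  conv_rhs => rw [← Finset.map_orderEmbOfFin_univ W h]
  rw [Finset.prod_map]
  rfl

/-- **Running sign along an enumeration.**  For a nowhere-zero sequence `a : Fin (k+1) → ℝ` and the set `F` of flip positions
(`a i.castSucc · a i.succ < 0`), the sign of `a i₀` relative to `a 0` is `(−1)^{#{i ∈ F : i < i₀}}`. [folklore] -/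
theorem sign_run {k : ℕ} (a : Fin (k + 1) → ℝ) (ha : ∀ i, a i ≠ 0) (i₀ : Fin (k + 1)) :
    0 < a 0 * a i₀ * (-1) ^ ((Finset.univ.filter fun i : Fin k => a i.castSucc * a i.succ < 0 ∧ (i : ℕ) < i₀).card) := by
  classical
  induction i₀ using Fin.induction with
  | zero =>
    have h0 : (Finset.univ.filter fun i : Fin k => a i.castSucc * a i.succ < 0 ∧ (i : ℕ) < ((0 : Fin (k+1)) : ℕ)) = ∅ := by
      ext i; simp
    rw [h0, Finset.card_empty, pow_zero, mul_one]
    exact mul_self_pos.2 (ha 0)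
  | succ i₀ ih =>
    -- split off the position `i₀`
    have hsplit : (Finset.univ.filter fun i : Fin k => a i.castSucc * a i.succ < 0 ∧ (i : ℕ) < (i₀.succ : ℕ)) =
        (Finset.univ.filter fun i : Fin k => a i.castSucc * a i.succ < 0 ∧ (i : ℕ) < (i₀.castSucc : ℕ)) ∪
          (if a i₀.castSucc * a i₀.succ < 0 then {i₀} else ∅) := by
      ext i
      simp only [Finset.mem_filter, Finset.mem_univ, true_and, Finset.mem_union, Fin.val_succ,
        Fin.val_castSucc]
      constructor
      · rintro ⟨hf, hi⟩
        rcases Nat.lt_succ_iff_lt_or_eq.1 hi with h | h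
        · exact Or.inl ⟨hf, h⟩
        · right
          have : i = i₀ := Fin.ext h
          subst this
          rw [if_pos hf]; exact Finset.mem_singleton_self _
      · rintro (⟨hf, h⟩ | h)
        · exact ⟨hf, Nat.lt_succ_of_lt h⟩
        · split_ifs at h with hf
          · rw [Finset.mem_singleton] at h; subst h; exact ⟨hf, Nat.lt_succ_self _⟩
          · exact absurd h (Finset.notMem_empty _)
    have hdisj : Disjoint (Finset.univ.filter fun i : Fin k => a i.castSucc * a i.succ < 0 ∧ (i : ℕ) < (i₀.castSucc : ℕ))
        (if a i₀.castSucc * a i₀.succ < 0 then {i₀} else ∅) := by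
      split_ifs
      · rw [Finset.disjoint_singleton_right, Finset.mem_filter]
        rintro ⟨-, -, h⟩; simp at h
      · exact disjoint_bot_right
    rw [hsplit, Finset.card_union_of_disjoint hdisj, pow_add]
    have hsq : 0 < a i₀.castSucc * a i₀.castSucc := mul_self_pos.2 (ha _)
    by_cases hf : a i₀.castSucc * a i₀.succ < 0
    · rw [if_pos hf, Finset.card_singleton, pow_one]
      -- a0 a(i₀+1) (-1)^c (-1) = [a0 a(i₀) (-1)^c] * [a(i₀) a(i₀+1)] * (-1) / a(i₀)^2
      have key : a 0 * a i₀.succ * ((-1) ^ (Finset.univ.filter fun i : Fin k =>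
            a i.castSucc * a i.succ < 0 ∧ (i : ℕ) < (i₀.castSucc : ℕ)).card * (-1)) * (a i₀.castSucc * a i₀.castSucc)
          = (a 0 * a i₀.castSucc * (-1) ^ (Finset.univ.filter fun i : Fin k =>
            a i.castSucc * a i.succ < 0 ∧ (i : ℕ) < (i₀.castSucc : ℕ)).card) * (-(a i₀.castSucc * a i₀.succ)) := by ring
      have : 0 < (a 0 * a i₀.castSucc * (-1) ^ (Finset.univ.filter fun i : Fin k =>
            a i.castSucc * a i.succ < 0 ∧ (i : ℕ) < (i₀.castSucc : ℕ)).card) * (-(a i₀.castSucc * a i₀.succ)) :=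
        mul_pos ih (by linarith)
      rw [← key] at this
      exact pos_of_mul_pos_left this hsq.le
    · rw [if_neg hf, Finset.card_empty, pow_zero, mul_one]
      have hpos : 0 < a i₀.castSucc * a i₀.succ :=
        lt_of_le_of_ne (not_lt.1 hf) (fun h => by rcases mul_eq_zero.1 h.symm with h | h <;> exact ha _ h)
      have key : a 0 * a i₀.succ * (-1) ^ (Finset.univ.filter fun i : Fin k =>
            a i.castSucc * a i.succ < 0 ∧ (i : ℕ) < (i₀.castSucc : ℕ)).card * (a i₀.castSucc * a i₀.castSucc)
          = (a 0 * a i₀.castSucc * (-1) ^ (Finset.univ.filter fun i : Fin k =>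
            a i.castSucc * a i.succ < 0 ∧ (i : ℕ) < (i₀.castSucc : ℕ)).card) * (a i₀.castSucc * a i₀.succ) := by ring
      have : 0 < (a 0 * a i₀.castSucc * (-1) ^ (Finset.univ.filter fun i : Fin k =>
            a i.castSucc * a i.succ < 0 ∧ (i : ℕ) < (i₀.castSucc : ℕ)).card) * (a i₀.castSucc * a i₀.succ) :=
        mul_pos ih hpos
      rw [← key] at this
      exact pos_of_mul_pos_left this hsq.le

/-- Midpoints of consecutive gaps of an increasingly enumerated set lie on the expected side of every element. [folklore] -/
theorem midpoint_side {N k : ℕ} (τ : Fin N → ℝ) (hτ : StrictMono τ) (A : Finset (Fin N)) (h : A.card = k + 1)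
    (i : Fin k) (i₀ : Fin (k + 1)) :
    ((i : ℕ) < i₀ → (τ (A.orderEmbOfFin h i.castSucc) + τ (A.orderEmbOfFin h i.succ)) / 2 < τ (A.orderEmbOfFin h i₀)) ∧
    (¬ (i : ℕ) < i₀ → τ (A.orderEmbOfFin h i₀) < (τ (A.orderEmbOfFin h i.castSucc) + τ (A.orderEmbOfFin h i.succ)) / 2) := by
  have hmono : StrictMono (fun i : Fin (k + 1) => τ (A.orderEmbOfFin h i)) :=
    hτ.comp (A.orderEmbOfFin h).strictMono
  have hlt : τ (A.orderEmbOfFin h i.castSucc) < τ (A.orderEmbOfFin h i.succ) :=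
    hmono (Fin.castSucc_lt_succ)
  constructor
  · intro hi
    have hle : τ (A.orderEmbOfFin h i.succ) ≤ τ (A.orderEmbOfFin h i₀) :=
      hmono.monotone (by rw [Fin.le_def, Fin.val_succ]; omega)
    linarith
  · intro hi
    have hle : τ (A.orderEmbOfFin h i₀) ≤ τ (A.orderEmbOfFin h i.castSucc) :=
      hmono.monotone (by rw [Fin.le_def, Fin.val_castSucc]; omega)
    linarith

/-- The gap midpoints of an increasingly enumerated set are strictly increasing. [folklore] -/
theorem midpoint_strictMono {N k : ℕ} (τ : Fin N → ℝ) (hτ : StrictMono τ) (A : Finset (Fin N)) (h : A.card = k + 1) :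
    StrictMono (fun i : Fin k => (τ (A.orderEmbOfFin h i.castSucc) + τ (A.orderEmbOfFin h i.succ)) / 2) := by
  have hmono : StrictMono (fun i : Fin (k + 1) => τ (A.orderEmbOfFin h i)) :=
    hτ.comp (A.orderEmbOfFin h).strictMono
  intro i i' hii'
  have h1 : τ (A.orderEmbOfFin h i.castSucc) < τ (A.orderEmbOfFin h i'.castSucc) :=
    hmono (by rw [Fin.lt_def, Fin.val_castSucc, Fin.val_castSucc]; exact hii')
  have h2 : τ (A.orderEmbOfFin h i.succ) < τ (A.orderEmbOfFin h i'.succ) :=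
    hmono (by rw [Fin.lt_def, Fin.val_succ, Fin.val_succ]; exact Nat.succ_lt_succ hii')
  show (τ (A.orderEmbOfFin h i.castSucc) + τ (A.orderEmbOfFin h i.succ)) / 2 <
    (τ (A.orderEmbOfFin h i'.castSucc) + τ (A.orderEmbOfFin h i'.succ)) / 2
  linarith

/-- **SIGN CUT BY FLIP MIDPOINTS.**  Increasing abscissae `τ`, a set `A` of `k + 1` indices enumerated increasingly by
`e = A.orderEmbOfFin h`, a function `f` nowhere zero on `A`.  Let `F` be the set of FLIP positions (`f(e i.castSucc)·f(e i.succ) < 0`)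
and `W` the set of the corresponding gap midpoints.  Then `|W| = |F|`, `W` avoids the abscissae of `A`, and the sign word of `f`
along `A` is CUT OUT by `W`: `0 < f(e 0) · f j · ∏_{x ∈ W} (x − τ_j)` for every `j ∈ A`. [folklore] -/
theorem signCut {N k : ℕ} (τ : Fin N → ℝ) (hτ : StrictMono τ) (A : Finset (Fin N)) (h : A.card = k + 1)
    (f : Fin N → ℝ) (hf : ∀ j ∈ A, f j ≠ 0) :
    ((Finset.univ.filter fun i : Fin k =>
        f (A.orderEmbOfFin h i.castSucc) * f (A.orderEmbOfFin h i.succ) < 0).image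
        (fun i : Fin k => (τ (A.orderEmbOfFin h i.castSucc) + τ (A.orderEmbOfFin h i.succ)) / 2)).card =
      (Finset.univ.filter fun i : Fin k =>
        f (A.orderEmbOfFin h i.castSucc) * f (A.orderEmbOfFin h i.succ) < 0).card ∧
    (∀ j ∈ A, ∀ x ∈ (Finset.univ.filter fun i : Fin k =>
        f (A.orderEmbOfFin h i.castSucc) * f (A.orderEmbOfFin h i.succ) < 0).image
        (fun i : Fin k => (τ (A.orderEmbOfFin h i.castSucc) + τ (A.orderEmbOfFin h i.succ)) / 2), x ≠ τ j) ∧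
    (∀ j ∈ A, 0 < f (A.orderEmbOfFin h 0) * f j * ∏ x ∈ (Finset.univ.filter fun i : Fin k =>
        f (A.orderEmbOfFin h i.castSucc) * f (A.orderEmbOfFin h i.succ) < 0).image
        (fun i : Fin k => (τ (A.orderEmbOfFin h i.castSucc) + τ (A.orderEmbOfFin h i.succ)) / 2), (x - τ j)) := by
  classical
  set e := A.orderEmbOfFin h with he
  set F := Finset.univ.filter fun i : Fin k => f (e i.castSucc) * f (e i.succ) < 0 with hF
  set mid := fun i : Fin k => (τ (e i.castSucc) + τ (e i.succ)) / 2 with hmid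
  have hinj : Set.InjOn mid F := (midpoint_strictMono τ hτ A h).injective.injOn
  -- every `j ∈ A` is some `e i₀`
  have hsurj : ∀ j ∈ A, ∃ i₀, e i₀ = j := by
    intro j hj
    have : j ∈ Set.range e := by rw [he, Finset.range_orderEmbOfFin]; exact hj
    exact this
  refine ⟨Finset.card_image_of_injOn hinj, ?_, ?_⟩
  · intro j hj x hx
    obtain ⟨i₀, rfl⟩ := hsurj j hj
    obtain ⟨i, hi, rfl⟩ := Finset.mem_image.1 hx
    rcases midpoint_side τ hτ A h i i₀ with ⟨h1, h2⟩
    by_cases hlt : (i : ℕ) < i₀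
    · exact ne_of_lt (h1 hlt)
    · exact ne_of_gt (h2 hlt)
  · intro j hj
    obtain ⟨i₀, rfl⟩ := hsurj j hj
    rw [Finset.prod_image hinj]
    -- running sign
    have ha : ∀ i, (f ∘ e) i ≠ 0 := fun i => hf _ (by rw [he]; exact A.orderEmbOfFin_mem h i)
    have hrun := sign_run (f ∘ e) ha i₀
    simp only [Function.comp] at hrun
    -- the filtered set of `sign_run` is `F.filter (· < i₀)`
    have hset : (Finset.univ.filter fun i : Fin k => f (e i.castSucc) * f (e i.succ) < 0 ∧ (i : ℕ) < i₀) =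
        F.filter fun i : Fin k => (i : ℕ) < i₀ := by
      rw [hF, Finset.filter_filter]
    rw [hset] at hrun
    -- sign of the product of the gap factors
    have hprod : 0 < (-1) ^ (F.filter fun i : Fin k => (i : ℕ) < i₀).card * ∏ i ∈ F, (mid i - τ (e i₀)) := by
      rw [← Finset.prod_filter_mul_prod_filter_not F (fun i : Fin k => (i : ℕ) < i₀), ← mul_assoc,
        ← Finset.prod_const (-1 : ℝ), ← Finset.prod_mul_distrib]
      refine mul_pos (Finset.prod_pos fun i hi => ?_) (Finset.prod_pos fun i hi => ?_)
      · have hi' := (Finset.mem_filter.1 hi).2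
        have := (midpoint_side τ hτ A h i i₀).1 hi'
        show 0 < -1 * (mid i - τ (e i₀))
        simp only [hmid] at this ⊢
        linarith
      · have hi' := (Finset.mem_filter.1 hi).2
        have := (midpoint_side τ hτ A h i i₀).2 hi'
        show 0 < mid i - τ (e i₀)
        simp only [hmid] at this ⊢
        linarith
    have hkey := mul_pos hrun hprod
    have hre : f (e 0) * f (e i₀) * (-1) ^ (F.filter fun i : Fin k => (i : ℕ) < i₀).card *
        ((-1) ^ (F.filter fun i : Fin k => (i : ℕ) < i₀).card * ∏ i ∈ F, (mid i - τ (e i₀))) =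
        (f (e 0) * f (e i₀) * ∏ i ∈ F, (mid i - τ (e i₀))) *
          ((-1) ^ (F.filter fun i : Fin k => (i : ℕ) < i₀).card) ^ 2 := by ring
    rw [hre] at hkey
    have hsq : 0 < ((-1 : ℝ) ^ (F.filter fun i : Fin k => (i : ℕ) < i₀).card) ^ 2 := by positivity
    exact pos_of_mul_pos_left hkey hsq.le

/-! ## §2 Zeros from flips; counting the flips of the alternating virtual signs along an honestly encoded touch set -/

/-- **Ordered zeros from flips.**  If a continuous `g` flips sign across `c` of the consecutive gaps of `A` (i.e. `c ≤ |F|` for the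
flip set `F` of `g ∘ τ` along `A`), then `g` has `c` strictly increasing zeros, all below the largest abscissa of `A` (one in each
flip gap, by the intermediate value theorem). [folklore] -/
theorem exists_zeros_of_flips {N k c : ℕ} (τ : Fin N → ℝ) (hτ : StrictMono τ) (A : Finset (Fin N)) (h : A.card = k + 1)
    (g : ℝ → ℝ) (hg : Continuous g)
    (hc : c ≤ (Finset.univ.filter fun i : Fin k =>
      g (τ (A.orderEmbOfFin h i.castSucc)) * g (τ (A.orderEmbOfFin h i.succ)) < 0).card) :
    ∃ z : Fin c → ℝ, StrictMono z ∧ (∀ i, g (z i) = 0) ∧ (∀ i, z i < τ (A.orderEmbOfFin h (Fin.last k))) := by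
  classical
  set e := A.orderEmbOfFin h with he
  have hmono : StrictMono (fun i : Fin (k + 1) => τ (e i)) := hτ.comp (A.orderEmbOfFin h).strictMono
  obtain ⟨F', hF', hcard⟩ := Finset.exists_subset_card_eq hc
  let ι : Fin c ↪o Fin k := F'.orderEmbOfFin hcard
  have hflip : ∀ i, g (τ (e (ι i).castSucc)) * g (τ (e (ι i).succ)) < 0 := fun i =>
    (Finset.mem_filter.1 (hF' (F'.orderEmbOfFin_mem hcard i))).2
  have hz : ∀ i, ∃ z : ℝ, τ (e (ι i).castSucc) < z ∧ z < τ (e (ι i).succ) ∧ g z = 0 := fun i => by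
    obtain ⟨z, hz, hgz⟩ := Census.RealExp.exists_zero_of_mul_neg (hmono (Fin.castSucc_lt_succ (i := ι i)))
      hg.continuousOn (hflip i)
    exact ⟨z, hz.1, hz.2, hgz⟩
  choose z hz1 hz2 hz3 using hz
  refine ⟨z, fun i i' hii' => ?_, hz3, fun i => lt_of_lt_of_le (hz2 i) (hmono.monotone (Fin.le_last _))⟩
  have h1 : (ι i).succ ≤ (ι i').castSucc := by
    rw [Fin.le_def, Fin.val_succ, Fin.val_castSucc]
    exact ι.strictMono hii'
  exact lt_trans (hz2 i) (lt_of_le_of_lt (hmono.monotone h1) (hz1 i'))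

/-- Splitting a «positions below» filter at a successor. [folklore] -/
theorem card_filter_lt_succ {k : ℕ} (F : Finset (Fin k)) (i₀ : Fin k) :
    (F.filter fun i : Fin k => (i : ℕ) < (i₀.succ : ℕ)).card =
      (F.filter fun i : Fin k => (i : ℕ) < (i₀.castSucc : ℕ)).card + (if i₀ ∈ F then 1 else 0) := by
  classical
  have hsplit : (F.filter fun i : Fin k => (i : ℕ) < (i₀.succ : ℕ)) =
      (F.filter fun i : Fin k => (i : ℕ) < (i₀.castSucc : ℕ)) ∪ (if i₀ ∈ F then {i₀} else ∅) := by
    ext i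
    simp only [Finset.mem_filter, Finset.mem_union, Fin.val_succ, Fin.val_castSucc]
    constructor
    · rintro ⟨hf, hi⟩
      rcases Nat.lt_succ_iff_lt_or_eq.1 hi with h | h
      · exact Or.inl ⟨hf, h⟩
      · right
        have : i = i₀ := Fin.ext h
        subst this
        rw [if_pos hf]; exact Finset.mem_singleton_self _
    · rintro (⟨hf, h⟩ | h)
      · exact ⟨hf, Nat.lt_succ_of_lt h⟩
      · split_ifs at h with hf
        · rw [Finset.mem_singleton] at h; subst h; exact ⟨hf, Nat.lt_succ_self _⟩
        · exact absurd h (Finset.notMem_empty _)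
  have hdisj : Disjoint (F.filter fun i : Fin k => (i : ℕ) < (i₀.castSucc : ℕ)) (if i₀ ∈ F then {i₀} else ∅) := by
    split_ifs
    · rw [Finset.disjoint_singleton_right, Finset.mem_filter]
      rintro ⟨-, h⟩; simp at h
    · exact disjoint_bot_right
  rw [hsplit, Finset.card_union_of_disjoint hdisj]
  split_ifs <;> simp

/-- **The alternating virtual signs**: `κ_j κ_{j+1} < 0` along `Fin 21` gives `0 < κ₀ κ_j (−1)^j`. [folklore] -/
theorem kappa_sign (κ : Fin 21 → ℝ) (halt : ∀ j : Fin 20, κ j.castSucc * κ j.succ < 0) (j : Fin 21) :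
    0 < κ 0 * κ j * (-1) ^ (j : ℕ) := by
  classical
  have hκ : ∀ j, κ j ≠ 0 := by
    intro j hz
    rcases Fin.eq_castSucc_or_eq_last j with ⟨m, hm⟩ | hlast
    · have := halt m; rw [← hm, hz, zero_mul] at this; exact lt_irrefl _ this
    · have := halt (Fin.last 19); rw [Fin.succ_last, ← hlast, hz, mul_zero] at this; exact lt_irrefl _ this
  have hrun := sign_run κ hκ j
  have hall : (Finset.univ.filter fun i : Fin 20 => κ i.castSucc * κ i.succ < 0 ∧ (i : ℕ) < j) =
      Finset.univ.filter fun i : Fin 20 => (i : ℕ) < j := by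
    ext i; simp [halt i]
  have hcard : (Finset.univ.filter fun i : Fin 20 => (i : ℕ) < j).card = (j : ℕ) := by
    have : (Finset.univ.filter fun i : Fin 20 => (i : ℕ) < j) = (Finset.univ : Finset (Fin j)).map
        (Fin.castLEEmb (by have := j.2; omega)) := by
      ext i
      simp only [Finset.mem_filter, Finset.mem_univ, true_and, Finset.mem_map, Fin.castLEEmb_apply]
      constructor
      · intro hi; exact ⟨⟨i, hi⟩, rfl⟩
      · rintro ⟨i', rfl⟩; exact i'.2
    rw [this, Finset.card_map, Finset.card_univ, Fintype.card_fin]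
  rw [hall, hcard] at hrun
  exact hrun

/-- **Flips of `κ` are odd index gaps**: if `κ_a κ_b < 0` for `a < b` in `Fin 21` then `b − a` is odd. [folklore] -/
theorem odd_sub_of_kappa_flip (κ : Fin 21 → ℝ) (halt : ∀ j : Fin 20, κ j.castSucc * κ j.succ < 0) (a b : Fin 21)
    (hab : a ≤ b) (hflip : κ a * κ b < 0) : Odd ((b : ℕ) - a) := by
  have ha := kappa_sign κ halt a
  have hb := kappa_sign κ halt b
  have hprod : 0 < (κ 0 * κ a * (-1) ^ (a : ℕ)) * (κ 0 * κ b * (-1) ^ (b : ℕ)) := mul_pos ha hb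
  have hre : (κ 0 * κ a * (-1) ^ (a : ℕ)) * (κ 0 * κ b * (-1) ^ (b : ℕ)) =
      (κ 0) ^ 2 * ((-1) ^ (a : ℕ)) ^ 2 * ((κ a * κ b) * (-1) ^ ((b : ℕ) - a)) := by
    have : (-1 : ℝ) ^ (b : ℕ) = (-1) ^ (a : ℕ) * (-1) ^ ((b : ℕ) - a) := by
      rw [← pow_add]; congr 1; omega
    rw [this]; ring
  rw [hre] at hprod
  have h1 : 0 < (κ 0) ^ 2 * ((-1 : ℝ) ^ (a : ℕ)) ^ 2 := by
    have h0 : κ 0 ≠ 0 := by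
      intro hz; have := halt 0; rw [show (0 : Fin 20).castSucc = 0 from rfl, hz, zero_mul] at this
      exact lt_irrefl _ this
    positivity
  have h2 : 0 < (κ a * κ b) * (-1 : ℝ) ^ ((b : ℕ) - a) := pos_of_mul_pos_right hprod h1.le
  by_contra hodd
  rw [Nat.not_odd_iff_even] at hodd
  rw [hodd.neg_one_pow, mul_one] at h2
  exact lt_irrefl _ (h2.trans hflip)

/-- **Counting the flips of `κ` along an honestly encoded touch set.**  If `J ⊆ Fin 21` (with `|J| = k + 1`) avoids the first
and the last abscissa and contains no two adjacent indices, then the number of consecutive gaps of `J` across which the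
alternating `κ` flips is at most `20 − 2|J|`: consecutive gaps have index length `≥ 2`, flip gaps have ODD length hence `≥ 3`,
and all gaps fit into `{1, …, 19}`. [this work] -/
theorem card_kappaFlips_le (J : Finset (Fin 21)) {k : ℕ} (h : J.card = k + 1) (κ : Fin 21 → ℝ)
    (halt : ∀ j : Fin 20, κ j.castSucc * κ j.succ < 0) (h0 : (0 : Fin 21) ∉ J) (h20 : Fin.last 20 ∉ J)
    (hsep : ∀ j : Fin 20, j.castSucc ∈ J → j.succ ∉ J) :
    (Finset.univ.filter fun i : Fin k =>
        κ (J.orderEmbOfFin h i.castSucc) * κ (J.orderEmbOfFin h i.succ) < 0).card + 2 * (k + 1) ≤ 20 := by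
  classical
  set e := J.orderEmbOfFin h with he
  set F := Finset.univ.filter fun i : Fin k => κ (e i.castSucc) * κ (e i.succ) < 0 with hF
  have hemem : ∀ i, e i ∈ J := fun i => by rw [he]; exact J.orderEmbOfFin_mem h i
  -- consecutive gaps have length ≥ 2, flip gaps ≥ 3
  have hgap : ∀ i : Fin k, ((e i.castSucc : Fin 21) : ℕ) + 2 + (if i ∈ F then 1 else 0) ≤ ((e i.succ : Fin 21) : ℕ) := by
    intro i
    have hlt : e i.castSucc < e i.succ := e.strictMono Fin.castSucc_lt_succ
    have hlt' : ((e i.castSucc : Fin 21) : ℕ) < ((e i.succ : Fin 21) : ℕ) := hlt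
    -- not adjacent
    have hne : ((e i.castSucc : Fin 21) : ℕ) + 1 ≠ ((e i.succ : Fin 21) : ℕ) := by
      intro hadj
      have hlt20 : ((e i.castSucc : Fin 21) : ℕ) < 20 := by have := (e i.succ).2; omega
      have h1 := hsep ⟨(e i.castSucc : Fin 21), hlt20⟩
      have hc : (⟨((e i.castSucc : Fin 21) : ℕ), hlt20⟩ : Fin 20).castSucc = e i.castSucc := Fin.ext rfl
      have hs : (⟨((e i.castSucc : Fin 21) : ℕ), hlt20⟩ : Fin 20).succ = e i.succ := Fin.ext (by
        rw [Fin.val_succ]; exact hadj)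
      rw [hc, hs] at h1
      exact h1 (hemem _) (hemem _)
    split_ifs with hi
    · have hflip := (Finset.mem_filter.1 hi).2
      have hodd := odd_sub_of_kappa_flip κ halt (e i.castSucc) (e i.succ) hlt.le hflip
      obtain ⟨r, hr⟩ := hodd
      omega
    · omega
  -- running count: `e i₀ ≥ e 0 + 2 i₀ + #(flips below i₀)`
  have hrun : ∀ i₀ : Fin (k + 1), ((e 0 : Fin 21) : ℕ) + 2 * (i₀ : ℕ) +
      (F.filter fun i : Fin k => (i : ℕ) < i₀).card ≤ ((e i₀ : Fin 21) : ℕ) := by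
    intro i₀
    induction i₀ using Fin.induction with
    | zero =>
      have : (F.filter fun i : Fin k => (i : ℕ) < ((0 : Fin (k + 1)) : ℕ)) = ∅ := by ext i; simp
      rw [this]; simp
    | succ i₀ ih =>
      rw [card_filter_lt_succ F i₀]
      have := hgap i₀
      have hcs : ((i₀.castSucc : Fin (k + 1)) : ℕ) = (i₀ : ℕ) := Fin.val_castSucc i₀
      rw [Fin.val_succ]
      rw [hcs] at ih
      simp only [hcs] at *
      omega
  have hlast := hrun (Fin.last k)
  have hfull : (F.filter fun i : Fin k => (i : ℕ) < ((Fin.last k : Fin (k + 1)) : ℕ)) = F := by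
    ext i; simp only [Finset.mem_filter, Fin.val_last, and_iff_left_iff_imp]; exact fun _ => i.2
  rw [hfull] at hlast
  -- e 0 ≥ 1 and e last ≤ 19
  have h0' : 1 ≤ ((e 0 : Fin 21) : ℕ) := by
    by_contra hlt
    have : e 0 = 0 := Fin.ext (by omega)
    exact h0 (this ▸ hemem 0)
  have h19 : ((e (Fin.last k) : Fin 21) : ℕ) ≤ 19 := by
    by_contra hlt
    have : e (Fin.last k) = Fin.last 20 := Fin.ext (by have := (e (Fin.last k)).2; rw [Fin.val_last]; omega)
    exact h20 (this ▸ hemem _)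
  rw [Fin.val_last] at hlast
  omega

end Summit.ValiantsHypothesis.ValiantsHypothesis.Theorems.LacunarySymmetroidMatrixDescartes.WallBubbling
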